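import Literature.MathematicalPhysics.QuantumFieldTheory.OSTimeSlice
import Literature.MathematicalPhysics.QuantumFieldTheory.OSTimePaleyWienerTools
import Literature.Analysis.FunctionSpaces.SchwartzPolyKernel
import HarnessLib

/-!
# The smeared function of one complex variable along a temporal direction

Second support file (everything proved) for the Paley–Wiener half of (A2)
`OS1975_boundaryValue_of_timeContinuation` (`OSTimeContinuation`; OS II (1975), §IV.2, p. 289:
"By standard arguments (see Vladimirov, p. 235 ff.) Theorem 4.3 implies … supp W̃ₙ ⊆ ℝ̄₊^{4n}").
For `𝔚` continuous on the time tube, holomorphic in the times and of OS growth (hypotheses in the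
form of `OSTimeSlice`), a Schwartz `F`, a height `Y ∈ T₊` and a temporal direction `η ∈ T₊`, the
**smeared function** `k(κ) = ∫ 𝔚((x + iY) + κη) F(x) dx` (`smearedFn`) is

* holomorphic on the gap set `⊇ {Im κ ≥ 0}` (`differentiableOn_smearedFn`,
  from `differentiableOn_integral_rayC_I_add_smul`), continuous on `{Im κ ≥ 0}`;
* polynomially bounded there: `‖k(κ)‖ ≤ A (1 + |κ|)^{2N}` (`exists_norm_smearedFn_le`);
* on the real axis a translate pairing, `k(s) = ∫ 𝔚(x + iY) F(x − sη) dx` (`smearedFn_ofReal`), so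
  that `∫ ρ(s) k(s) ds = ∫ 𝔚(x + iY) (∫ ρ(s) F(x − sη) ds) dx` (`integral_mul_smearedFn_eq`, Fubini);
* and the **Paley–Wiener vanishing** `integral_fourierInv_mul_smearedFn_eq_zero`: `∫ (𝓕⁻¹g)(s) k(s) ds = 0`
  for every Schwartz `g` with compact support in `[0, ∞)` — the product `R[g] · k` is holomorphic and
  `O((1 + |κ|)^{-2})` on `{Im ≥ 0}` (`exists_norm_laplaceExt_le`), so the line of integration can be
  pushed to `+i∞` (`integral_eq_zero_of_norm_le_upperHalfPlane`).

## References

* K. Osterwalder, R. Schrader, *Axioms for Euclidean Green's functions II*, Comm. Math. Phys. 42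
  (1975) 281–305, §IV.2. [OsterwalderSchraderCMP1975]
* R. F. Streater, A. S. Wightman, *PCT, Spin and Statistics, and All That* (1964), §2-3,
  Thm. 2-8. [StreaterWightman1964]
* V. S. Vladimirov, *Methods of the Theory of Functions of Many Complex Variables* (1966), §26.
  [Vladimirov1966]
-/

noncomputable section

open Filter Topology Complex MeasureTheory Set Metric
open scoped SchwartzMap Real FourierTransform RealInnerProductSpace
open Literature.MathematicalPhysics.QuantumLattice Literature.Analysis.FunctionSpaces

namespace Literature.MathematicalPhysics.QuantumFieldTheory

variable {d n : ℕ}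

/-! ### The admissible parameters of a complex temporal line -/

/-- For `Y, η ∈ T₊` the parameters `κ` with `Im κ ≥ 0` keep `Y + Im κ η` in the temporal cone (the
gap condition of `differentiableOn_integral_rayC_I_add_smul`). [folklore] -/
theorem gap_pos_of_im_nonneg {Y η : Fin n → SpaceTime d} (hY : Y ∈ temporalCone d n)
    (hη : η ∈ temporalCone d n) {κ : ℂ} (hκ : 0 ≤ κ.im) (k : Fin n) :
    0 < succDiff (fun j => Y j 0) k + κ.im * succDiff (fun j => η j 0) k :=
  add_pos_of_pos_of_nonneg (((mem_temporalCone_iff Y).1 hY).2 k)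
    (mul_nonneg hκ (((mem_temporalCone_iff η).1 hη).2 k).le)

/-! ### The smeared function `k(κ) = ∫ 𝔚((x + iY) + κη) F(x) dx` of one complex variable -/

section Smeared

variable {𝔚 : (Fin n → Fin (d + 1) → ℂ) → ℂ} {C : ℝ} {N : ℕ}
  (hGc : ContinuousOn 𝔚 (timeTube d n)) (hGh : IsTimeHolomorphicOn 𝔚 (timeTube d n))
  (hG : ∀ z ∈ timeTube d n, ‖𝔚 z‖ ≤ C * (1 + ‖z‖) ^ N *
    (1 + ∑ k, ((succDiff (fun j => z j 0) k).im)⁻¹) ^ N)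

variable (𝔚) in
/-- The **smeared function of one complex variable** along the temporal direction `η` at the
height `Y`: `k(κ) = ∫ 𝔚((x + iY) + κη) F(x) dx` (the Paley–Wiener argument runs in the variable
`κ`). [folklore] -/
def smearedFn (F : 𝓢((Fin n → SpaceTime d), ℂ)) (Y η : Fin n → SpaceTime d) (κ : ℂ) : ℂ :=
  ∫ x, 𝔚 (rayC x Y I + κ • cpxConfig η) * F x

include hGc hGh hG in
/-- The smeared function is holomorphic on the gap set `{κ | gaps of Y + Im κ η > 0} ⊇ {Im κ ≥ 0}`
(`differentiableOn_integral_rayC_I_add_smul`). [folklore] -/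
theorem differentiableOn_smearedFn (F : 𝓢((Fin n → SpaceTime d), ℂ)) {Y η : Fin n → SpaceTime d}
    (hY : Y ∈ temporalCone d n) (hη : η ∈ temporalCone d n) :
    DifferentiableOn ℂ (smearedFn 𝔚 F Y η)
      {κ : ℂ | ∀ k, 0 < succDiff (fun j => Y j 0) k + κ.im * succDiff (fun j => η j 0) k} :=
  differentiableOn_integral_rayC_I_add_smul hGc hGh hG ((mem_temporalCone_iff Y).1 hY).1
    ((mem_temporalCone_iff η).1 hη).1 F

include hGc hGh hG in
/-- The smeared function is continuous on the closed upper half-plane. [folklore] -/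
theorem continuousOn_smearedFn (F : 𝓢((Fin n → SpaceTime d), ℂ)) {Y η : Fin n → SpaceTime d}
    (hY : Y ∈ temporalCone d n) (hη : η ∈ temporalCone d n) :
    ContinuousOn (smearedFn 𝔚 F Y η) {κ : ℂ | 0 ≤ κ.im} :=
  (differentiableOn_smearedFn hGc hGh hG F hY hη).continuousOn.mono
    fun _ hκ k => gap_pos_of_im_nonneg hY hη hκ k

include hG in
/-- **Polynomial bound of the smeared function on the closed upper half-plane**:
`‖k(κ)‖ ≤ A (1 + ‖κ‖)^{2N}` for `Im κ ≥ 0` (OS growth along `Y + Im κ η`, which grows like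
`(1 + Im κ)ᴺ`, and the shift of the base point by `Re κ η`). [folklore] -/
theorem exists_norm_smearedFn_le (F : 𝓢((Fin n → SpaceTime d), ℂ)) {Y η : Fin n → SpaceTime d}
    (hY : Y ∈ temporalCone d n) (hη : η ∈ temporalCone d n) :
    ∃ A : ℝ, 0 ≤ A ∧ ∀ κ : ℂ, 0 ≤ κ.im → ‖smearedFn 𝔚 F Y η κ‖ ≤ A * (1 + ‖κ‖) ^ (2 * N) := by
  have hC := nonneg_of_osGrowth hG
  have hηc := (mem_temporalCone_iff η).1 hη
  have hgapY : 0 ≤ 1 + ∑ k, (succDiff (fun j => Y j 0) k)⁻¹ :=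
    add_nonneg zero_le_one (Finset.sum_nonneg fun k _ => (inv_pos.2 (((mem_temporalCone_iff Y).1 hY).2 k)).le)
  set B : ℝ := C * ((1 + ‖Y‖) ^ N * (1 + ∑ k, (succDiff (fun j => Y j 0) k)⁻¹) ^ N * (1 + ‖η‖) ^ N) *
    (1 + ‖η‖) ^ N with hB
  have hB0 : 0 ≤ B := by rw [hB]; positivity
  set J : ℝ := ∫ x, (1 + ‖x‖) ^ N * ‖F x‖ with hJ
  have hJ0 : 0 ≤ J := integral_nonneg fun _ => by positivity
  refine ⟨B * J, by positivity, fun κ hκ => ?_⟩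
  have hpt : ∀ x, ‖𝔚 (rayC x Y I + κ • cpxConfig η) * F x‖ ≤ B * (1 + ‖κ‖) ^ (2 * N) * ((1 + ‖x‖) ^ N * ‖F x‖) := by
    intro x
    rw [norm_mul, rayC_I_add_smul_cpxConfig]
    have h1 := norm_apply_rayC_I_add_smul_le hG hY hηc.1 (fun k => (hηc.2 k).le) hκ (x + κ.re • η)
    have hre : |κ.re| ≤ ‖κ‖ := abs_re_le_norm κ
    have him : κ.im ≤ ‖κ‖ := (le_abs_self _).trans (abs_im_le_norm κ)
    have hn1 : 1 + ‖x + κ.re • η‖ ≤ (1 + ‖η‖) * (1 + ‖κ‖) * (1 + ‖x‖) := by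
      have h2 : ‖x + κ.re • η‖ ≤ ‖x‖ + ‖κ‖ * ‖η‖ := by
        refine (norm_add_le _ _).trans (add_le_add le_rfl ?_)
        rw [norm_smul, Real.norm_eq_abs]
        exact mul_le_mul_of_nonneg_right hre (norm_nonneg _)
      nlinarith [norm_nonneg x, norm_nonneg κ, norm_nonneg η, mul_nonneg (norm_nonneg κ) (norm_nonneg η),
        mul_nonneg (norm_nonneg x) (norm_nonneg κ), mul_nonneg (norm_nonneg x) (norm_nonneg η),
        mul_nonneg (mul_nonneg (norm_nonneg x) (norm_nonneg κ)) (norm_nonneg η)]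
    have h3 : (1 + ‖x + κ.re • η‖) ^ N ≤ ((1 + ‖η‖) * (1 + ‖κ‖) * (1 + ‖x‖)) ^ N :=
      pow_le_pow_left₀ (by positivity) hn1 N
    have h4 : (1 + κ.im) ^ N ≤ (1 + ‖κ‖) ^ N := pow_le_pow_left₀ (by linarith) (by linarith) N
    calc ‖𝔚 (rayC (x + κ.re • η) (Y + κ.im • η) I)‖ * ‖F x‖
        ≤ (C * ((1 + ‖Y‖) ^ N * (1 + ∑ k, (succDiff (fun j => Y j 0) k)⁻¹) ^ N * (1 + ‖η‖) ^ N) *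
            (1 + κ.im) ^ N * (1 + ‖x + κ.re • η‖) ^ N) * ‖F x‖ :=
          mul_le_mul_of_nonneg_right h1 (norm_nonneg _)
      _ ≤ (C * ((1 + ‖Y‖) ^ N * (1 + ∑ k, (succDiff (fun j => Y j 0) k)⁻¹) ^ N * (1 + ‖η‖) ^ N) *
            (1 + ‖κ‖) ^ N * ((1 + ‖η‖) * (1 + ‖κ‖) * (1 + ‖x‖)) ^ N) * ‖F x‖ := by
          gcongr
      _ = B * (1 + ‖κ‖) ^ (2 * N) * ((1 + ‖x‖) ^ N * ‖F x‖) := by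
          rw [hB, mul_pow, mul_pow, two_mul, pow_add]; ring
  calc ‖smearedFn 𝔚 F Y η κ‖ ≤ ∫ x, B * (1 + ‖κ‖) ^ (2 * N) * ((1 + ‖x‖) ^ N * ‖F x‖) :=
        norm_integral_le_of_norm_le ((integrable_one_add_norm_pow_mul_norm (μ := volume) F N).const_mul _)
          (Eventually.of_forall hpt)
    _ = B * J * (1 + ‖κ‖) ^ (2 * N) := by rw [integral_const_mul, hJ]; ring

/-- **On the real axis the smeared function is a translate integral**:
`k(s) = ∫ 𝔚(x + iY) F(x − sη) dx`. [folklore] -/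
theorem smearedFn_ofReal (F : 𝓢((Fin n → SpaceTime d), ℂ)) (Y η : Fin n → SpaceTime d) (s : ℝ) :
    smearedFn 𝔚 F Y η s = ∫ x, 𝔚 (rayC x Y I) * F (x - s • η) := by
  unfold smearedFn
  have hpt : ∀ x, rayC x Y I + (s : ℂ) • cpxConfig η = rayC (x + s • η) Y I := fun x => by
    rw [rayC_I_add_smul_cpxConfig]; simp
  simp only [hpt]
  have h := integral_add_right_eq_self (μ := (volume : Measure (Fin n → SpaceTime d)))
    (fun x => 𝔚 (rayC x Y I) * F (x - s • η)) (s • η)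
  simp only [add_sub_cancel_right] at h
  exact h

include hGc hG in
/-- **The smeared function paired with a Schwartz function**:
`∫ ρ(s) k(s) ds = ∫ 𝔚(x + iY) (∫ ρ(s) F(x − sη) ds) dx` (Fubini,
`Literature.Analysis.FunctionSpaces.integral_mul_integral_mul_comp_sub_smul`). [folklore] -/
theorem integral_mul_smearedFn_eq (ρ : 𝓢(ℝ, ℂ)) (F : 𝓢((Fin n → SpaceTime d), ℂ))
    {Y : Fin n → SpaceTime d} (hY : Y ∈ temporalCone d n) (η : Fin n → SpaceTime d) :
    ∫ s, ρ s * smearedFn 𝔚 F Y η s = ∫ x, 𝔚 (rayC x Y I) * ∫ s, ρ s * F (x - s • η) := by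
  have h := Literature.Analysis.FunctionSpaces.integral_mul_integral_mul_comp_sub_smul (μ := volume)
    (continuous_apply_rayC_I hGc hY).aestronglyMeasurable (norm_apply_rayC_I_le hG hY) ρ F η
  rw [← h]
  refine integral_congr_ae (Eventually.of_forall fun s => ?_)
  show ρ s * smearedFn 𝔚 F Y η s = ρ s * ∫ x, 𝔚 (rayC x Y I) * F (x - s • η)
  rw [smearedFn_ofReal]

include hGc hGh hG in
/-- **The smeared function annihilates functions with spectrum in `[0, ∞)`**: for a Schwartz `g`
on `ℝ` with compact support in `[0, ∞)`, `∫ (𝓕⁻¹g)(s) k(s) ds = 0` — `R[g] · k` is holomorphic on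
`{Im ≥ 0}` and `O((1 + |κ|)^{-2})` there (`k` grows like `(1 + |κ|)^{2N}`, `R[g]` decays like
`(1 + |κ|)^{-2N-2}`, `exists_norm_laplaceExt_le`), so the line of integration can be pushed to `+i∞`
(`integral_eq_zero_of_norm_le_upperHalfPlane`). [cite: StreaterWightman1964, Thm 2-8] -/
theorem integral_fourierInv_mul_smearedFn_eq_zero (F : 𝓢((Fin n → SpaceTime d), ℂ))
    {Y η : Fin n → SpaceTime d} (hY : Y ∈ temporalCone d n) (hη : η ∈ temporalCone d n)
    (g : 𝓢(ℝ, ℂ)) (hgc : HasCompactSupport g) (hg0 : tsupport (⇑g) ⊆ Ici 0) :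
    ∫ s : ℝ, (𝓕⁻ (g : ℝ → ℂ)) s * smearedFn 𝔚 F Y η s = 0 := by
  obtain ⟨A, hA0, hA⟩ := exists_norm_smearedFn_le hG F hY hη
  obtain ⟨C', hC'0, hC'⟩ := exists_norm_laplaceExt_le g hgc hg0 (2 * N + 2)
  set Φ : ℂ → ℂ := fun κ => laplaceExt g κ * smearedFn 𝔚 F Y η κ with hΦ
  have hΦd : DifferentiableOn ℂ Φ {κ : ℂ | 0 ≤ κ.im} :=
    ((differentiable_laplaceExt hgc g.integrable).differentiableOn).mul
      ((differentiableOn_smearedFn hGc hGh hG F hY hη).mono fun _ hκ k => gap_pos_of_im_nonneg hY hη hκ k)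
  have hΦb : ∀ κ : ℂ, 0 ≤ κ.im → ‖Φ κ‖ ≤ (C' * A) * ((1 + ‖κ‖) ^ 2)⁻¹ := by
    intro κ hκ
    rw [hΦ, norm_mul]
    have h1 : 0 < 1 + ‖κ‖ := by positivity
    calc ‖laplaceExt g κ‖ * ‖smearedFn 𝔚 F Y η κ‖
        ≤ (C' * ((1 + ‖κ‖) ^ (2 * N + 2))⁻¹) * (A * (1 + ‖κ‖) ^ (2 * N)) :=
          mul_le_mul (hC' κ hκ) (hA κ hκ) (norm_nonneg _) (by positivity)
      _ = (C' * A) * ((1 + ‖κ‖) ^ 2)⁻¹ := by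
          rw [pow_add]
          field_simp
  have h := integral_eq_zero_of_norm_le_upperHalfPlane Φ hΦd hΦb
  rw [← h]
  refine integral_congr_ae (Eventually.of_forall fun s => ?_)
  simp only [hΦ, laplaceExt_ofReal]

end Smeared

end Literature.MathematicalPhysics.QuantumFieldTheory
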